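import Summits.BirchSwinnertonDyer.Rank1Residual.Additive.GoodModelKummerLeGreenbergLevel
import Summits.BirchSwinnertonDyer.Rank1Residual.Additive.GoodModelReductionLine
import Summits.BirchSwinnertonDyer.Rank1Residual.X2.GreenbergVatsalStrictAtPQuotient
import Literature.NumberTheory.EllipticCurves.GoodModelInertiaCriterionProofs
import Mathlib.GroupTheory.Perm.Support
import HarnessLib

/-!
# The inertia DICHOTOMY on the reduction line of a good model (`p ≥ 5`): an inertial element
# fixing ONE non-zero vector of `E[p^∞]/C` acts trivially on it — and a FREE element of
# `I_v ∩ Gal(ℚ̄/ℚ_∞)` from a prime-to-`p` normal fixing level — row T-RD-E346 file K3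
# (cell `b2b-bsdres`, team n1011; seat n1011-p05 gen 6)

HONEST FRAMING (cell `b2b-bsdres`, run/shared/lean/b2b/bsd-rank1-residual/, verbatim in every
file): the goal of the cell is to DELETE the COMBINATION-SHAPED residual classes of the
Birch–Swinnerton-Dyer formula for ALL analytic-rank `≤ 1` elliptic curves over `ℚ` — "full BSD
formula for every rank `≤ 1` curve in class `C`" assembled STRICTLY from published theorems — so
that the rank-`≤ 1` remainder becomes exactly the CONSTRUCTION-SHAPED classes, which are TYPED
(missing-input `Prop`s), NOT attempted. This is not "finishing BSD". Team n1011 (X4 ∧ `p = 3`,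
§I N10/N11; Route G δ-input on the `(G-ord)` rows with `e ∈ {3,4,6}`): research route; TOOL theorems,
ALL UNCONDITIONAL (no named fact enters this file); no definition, no named fact; nothing booked;
no label changes.

## What

Setting of T-ROL-G F-A2/F-A3: `E = W/ℚ` elliptic, `v ∋ p`, a GOOD MODEL `W₀ = C • E ⊗ K̄_v` over the
valuation ring of the spectral valuation of `K̄_v`, `red = red_{W₀} ∘ Φ_C`, the datum
`Lv.plus = C := E[p^∞] ∩ ker red`, the ordinary input `hord`.

* §1 `VariableChange.eq_one_of_fixed_of_coprime_nsmul` — over any field: a change of variables `Ã`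
  with `Ã • V = V` whose induced self-map of `V(k)` fixes a non-zero point `Q` killed by an `N`
  prime to `6` is `1` (it fixes `Q`, `−Q`, `2Q`: three affine points over two abscissae — the
  tree's `VariableChange.eq_one_of_three_fixedPoints`, Silverman III.10).
* §2 `red_smul_eq_of_smul_sub_mem_plus` — THE DICHOTOMY (`p ≥ 5`): if an INERTIAL
  `σ ∈ Γ_{ℚ_v}` satisfies `σm − m ∈ C` for ONE `m ∈ E[p^∞] ∖ C`, then `red(σP) = red(P)` for EVERY
  `P ∈ E(K̄_v)` — in particular `σ` acts trivially on `E[p^∞]/C`. Mechanism: Serre–Tate's reduced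
  automorphism `Ã_σ` (`exists_reducedAut_red_map_eq`: `red(Φ(P^σ)) = Ã_σ(red(Φ P))`) fixes the
  reduction `Q ≠ Õ` of `m`, a point of `p`-power order, so `Ã_σ = 1` by §1. Equivalently: every
  inertial element acts on `E[p^∞]/C ≅ Ẽ₀[p^∞]` either TRIVIALLY or FREELY (Gr-form
  `smul_eq_self_of_exists`): the quotient character `ϑ : I_v → Aut(Ẽ₀) ↪ ℤ_p^×` takes values in
  roots of unity `ζ` with `ζ − 1` a unit.
* §3 `forall_fixed_eq_zero_of_goodModel_of_level` — at a BAD place (`¬ good at v`), for the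
  cyclotomic `κ` and a NORMAL open `U ≤ Γ_ℚ` with `p ∤ [Γ_ℚ : U]` whose local elements fix `C`:
  `E[p^∞]/C` has NO non-zero vector fixed by `I_v ∩ ker κ` — the input `hfix` of p05 F3
  `greenbergKer_eq_strictKer_of_forall_fixed_eq_zero` ('Greenberg = strict' at `ker κ`). Proof:
  `σ₀ ∈ I_v` moves `E[p^∞]/C` (F-A3, Néron–Ogg–Shafarevich); `σ^{[Γ:U]}` fixes `C`
  (`Subgroup.pow_index_mem`) hence acts trivially (K2); so `σ₀^{p^B}` still moves it (the order of
  `σ₀` on `E[p^∞]/C` divides `[Γ : U]`, prime to `p`; `exists_pow_eq_self_of_coprime`); X2's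
  `exists_layer_le_kappa_inertia` gives `w ∈ U ∩ I_v` with `κ w = κ σ₀^{p^B}`, acting trivially;
  `τ := σ₀^{p^B} w⁻¹ ∈ I_v ∩ ker κ` moves `E[p^∞]/C`, hence (§2) acts freely.

References: J.-P. Serre, J. Tate, Ann. of Math. 88 (1968) §2 Thm. 2 [SerreTate1968]; J. H.
Silverman, *AEC* 2nd ed. III.10, VII.2.1, VII.3.1(b), VII.7.1 [SilvermanAEC2009]; R. Greenberg,
LNM 1716 (1999) §2 p. 73 [GreenbergLNM1716]; R. Greenberg, Adv. Stud. Pure Math. 17 (1989) §1 p. 98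
[Greenberg1989]; skeleton `cells/n1011/skel/T-RD-E346.md` (f88cc66b311ca16d).
-/

noncomputable section

open scoped Classical NNReal

open WeierstrassCurve

universe u

/-! ## §1 A change of variables fixing a point of order prime to `6` is the identity -/

namespace WeierstrassCurve.VariableChange

open Literature.NumberTheory.EllipticCurves

variable {k : Type*} [Field k] {V : WeierstrassCurve k}

/-- **A change of variables fixing a point of order prime to `6` is the identity.** If `Ã • V = V`
and the induced self-map `Q ↦ Ã(Q)` of `V(k)` (an additive bijection) fixes a point `Q ≠ O` with
`N • Q = O`, `gcd(N, 6) = 1`, then `Ã = 1`: it fixes `Q = (x₁, y₁)`, `−Q = (x₁, y₁')` with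
`y₁' ≠ y₁` (`2Q ≠ O`) and `2Q = (x₂, y₂)` with `x₂ ≠ x₁` (`Q ≠ O`, `3Q ≠ O`) — three affine fixed
points over two abscissae (`eq_one_of_three_fixedPoints`). [cite: SilvermanAEC2009, III.1 Table 3.1 and III.10] -/
theorem eq_one_of_fixed_of_coprime_nsmul {A : VariableChange k} (hA : A • V = V)
    (Q : V.toAffine.Point) (hQ : Q ≠ 0) {N : ℕ} (hN : N • Q = 0) (h2 : N.Coprime 2)
    (h3 : N.Coprime 3)
    (hfix : Affine.Point.congrEquiv hA (pointEquiv V A Q) = Q) : A = 1 := by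
  set ψ : V.toAffine.Point ≃+ V.toAffine.Point :=
    (pointEquiv V A).trans (Affine.Point.congrEquiv hA) with hψ
  have hψQ : ψ Q = Q := hfix
  have hψneg : ψ (-Q) = -Q := by rw [map_neg, hψQ]
  have hψ2 : ψ (2 • Q) = 2 • Q := by rw [map_nsmul, hψQ]
  -- an element killed by `N` and by `a` coprime to `N` is `O`
  have key : ∀ {a : ℕ}, N.Coprime a → a • Q = 0 → Q = 0 := fun {a} ha h ↦ by
    have h1 : addOrderOf Q ∣ 1 := by
      rw [← ha]
      exact Nat.dvd_gcd (addOrderOf_dvd_of_nsmul_eq_zero hN) (addOrderOf_dvd_of_nsmul_eq_zero h)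
    exact AddMonoid.addOrderOf_eq_one_iff.mp (Nat.dvd_one.mp h1)
  have h2Q : 2 • Q ≠ 0 := fun h ↦ hQ (key h2 h)
  have h3Q : 3 • Q ≠ 0 := fun h ↦ hQ (key h3 h)
  rcases Q with _ | ⟨x₁, y₁, h₁⟩
  · exact absurd rfl hQ
  have h₁' : V.toAffine.Nonsingular x₁ (V.toAffine.negY x₁ y₁) :=
    (Affine.nonsingular_neg ..).mpr h₁
  have hneg : -(Affine.Point.some x₁ y₁ h₁) = Affine.Point.some x₁ (V.toAffine.negY x₁ y₁) h₁' := rfl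
  -- `y₁' ≠ y₁`
  have hy : y₁ ≠ V.toAffine.negY x₁ y₁ := by
    intro heq
    apply h2Q
    have hQneg : -(Affine.Point.some x₁ y₁ h₁) = Affine.Point.some x₁ y₁ h₁ := by
      rw [hneg]; exact point_some_congr rfl heq.symm
    rw [two_nsmul]
    nth_rewrite 2 [← hQneg]
    exact add_neg_cancel _
  -- `2Q = (x₂, y₂)` with `x₂ ≠ x₁`
  rcases h2Q' : (2 • Affine.Point.some x₁ y₁ h₁) with _ | ⟨x₂, y₂, h₂⟩
  · exact absurd h2Q' h2Q
  have hx : x₂ ≠ x₁ := by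
    intro hx
    rcases Affine.Y_eq_of_X_eq h₂.left h₁.left hx with hyy | hyy
    · -- `2Q = Q`
      apply hQ
      have e : 2 • Affine.Point.some x₁ y₁ h₁ = Affine.Point.some x₁ y₁ h₁ := by
        rw [h2Q']; exact point_some_congr hx hyy
      rw [two_nsmul] at e
      exact add_eq_left.mp e
    · -- `2Q = -Q`, so `3Q = O`
      apply h3Q
      have e : 2 • Affine.Point.some x₁ y₁ h₁ = -Affine.Point.some x₁ y₁ h₁ := by
        rw [h2Q', hneg]; exact point_some_congr hx hyy
      rw [succ_nsmul, e, neg_add_cancel]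
  refine eq_one_of_three_fixedPoints hA h₁ h₁' h₂ hy hx hfix ?_ ?_
  · have h := hψneg
    rw [hneg] at h
    exact h
  · have h := hψ2
    rw [h2Q'] at h
    exact h

end WeierstrassCurve.VariableChange

namespace Summit.BirchSwinnertonDyer.Rank1Residual.Additive.GoodModelLine

open NumberField IsDedekindDomain Field IsDedekindDomain.HeightOneSpectrum
  Literature.NumberTheory.GaloisRepresentations Literature.NumberTheory.EllipticCurves
  Literature.NumberTheory.EllipticCurves.GreenbergSelmer
  Literature.NumberTheory.EllipticCurves.EmertonPollackWeston2006
  Summit.BirchSwinnertonDyer.Rank1Residual.X2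
  Summit.BirchSwinnertonDyer.Rank1Residual.X2.GreenbergVatsalReductionDatum
  Summit.BirchSwinnertonDyer.Rank1Residual.X2.GreenbergVatsalTateDatumCofree
  Summit.BirchSwinnertonDyer.Rank1Residual.X2.GreenbergVatsalStrictAtPQuotient

variable (W : WeierstrassCurve ℚ) [W.IsElliptic] (p : ℕ) [hp : Fact p.Prime]
  {v : HeightOneSpectrum (𝓞 ℚ)}
  {C : VariableChange (AlgebraicClosure (v.adicCompletion ℚ))}
  {W₀ : WeierstrassCurve (specVal v).integer}
  (hW₀ : C • (W.baseChange (v.adicCompletion ℚ)).baseChange (AlgebraicClosure (v.adicCompletion ℚ)) =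
    W₀.baseChange (AlgebraicClosure (v.adicCompletion ℚ)))
  (hΔ : IsUnit W₀.Δ)
  (red : localPoints W (v.adicCompletion ℚ) →+
    (W₀.map (IsLocalRing.residue (specVal v).integer)).toAffine.Point)
  (hred : ∀ P, red P = goodReductionHom W₀ (Valuation.integer.integers (specVal v)) hΔ
    (Affine.Point.congrEquiv hW₀ (VariableChange.pointEquiv _ C
      (Affine.Point.congrEquiv (baseChange_baseChange_adicCompletion W v).symm P))))
  (hord : ∃ P : (W₀.baseChange (AlgebraicClosure (v.adicCompletion ℚ))).toAffine.Point,
    (p : ℤ) • P = 0 ∧ goodReductionHom W₀ (Valuation.integer.integers (specVal v)) hΔ P ≠ 0)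
  (Lv : LocalDatum ℚ (W.geomPrimaryTorsion p) v)
  (hLv : ∀ m, m ∈ Lv.plus ↔ red (pointsMap W (v.adicCompletion ℚ) (m : W.geomPoints)) = 0)

/-! ## §2 The dichotomy: an inertial element fixing one non-zero vector of `E[p^∞]/C` acts
trivially -/

omit [W.IsElliptic] in
include hred hLv in
/-- **THE DICHOTOMY** (`p ≥ 5`). For an INERTIAL `σ ∈ Γ_{ℚ_v}` and ONE `m ∈ E[p^∞]` with `m ∉ C`
and `σm − m ∈ C` (`σ` fixes the non-zero vector `m mod C` of `E[p^∞]/C`): `red(σP) = red(P)` for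
EVERY `P ∈ E(K̄_v)`. The Serre–Tate reduced automorphism `Ã_σ` of `W̃₀`
(`exists_reducedAut_red_map_eq`) fixes `red(m) ≠ Õ`, a point of `p`-power order with `p ≥ 5`, so
`Ã_σ = 1` (`VariableChange.eq_one_of_fixed_of_coprime_nsmul`). [cite: SerreTate1968, §2 Thm. 2 (mechanism of proof)]
[cite: SilvermanAEC2009, Prop. VII.2.1 and III.10] -/
theorem red_smul_eq_of_smul_sub_mem_plus (hp5 : 5 ≤ p) {σ : absoluteGaloisGroup (v.adicCompletion ℚ)}
    (hσ : σ ∈ absInertia (v.adicCompletion ℚ)) {m : W.geomPrimaryTorsion p} (hm : m ∉ Lv.plus)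
    (hσm : absGaloisRestrict ℚ (v.adicCompletion ℚ) σ • m - m ∈ Lv.plus)
    (P : localPoints W (v.adicCompletion ℚ)) : red (σ • P) = red P := by
  obtain ⟨𝔐, h𝔐⟩ := v.localPrimesAbove_nonempty
  let Φ₁ : localPoints W (v.adicCompletion ℚ) ≃+
      ((W.baseChange (v.adicCompletion ℚ)).baseChange (AlgebraicClosure (v.adicCompletion ℚ))).toAffine.Point :=
    Affine.Point.congrEquiv (baseChange_baseChange_adicCompletion W v).symm
  have hredΦ : ∀ P, red P = goodReductionHom W₀ (Valuation.integer.integers (specVal v)) hΔ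
      (Affine.Point.congrEquiv hW₀ (VariableChange.pointEquiv _ C (Φ₁ P))) := fun P ↦ hred P
  have hΦ₁smul : ∀ Q : localPoints W (v.adicCompletion ℚ),
      Φ₁ (σ • Q) = Affine.Point.map ((absoluteGaloisGroup.toAlgEquiv (v.adicCompletion ℚ) σ) :
        AlgebraicClosure (v.adicCompletion ℚ) →ₐ[v.adicCompletion ℚ]
        AlgebraicClosure (v.adicCompletion ℚ)) (Φ₁ Q) :=
    fun Q ↦ congrEquiv_smul W v σ Q
  have hσv : ∀ z, specVal v ((absoluteGaloisGroup.toAlgEquiv (v.adicCompletion ℚ) σ) z) = specVal v z :=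
    fun z ↦ spectralValuation_smul (specVal_spec v) σ z
  have hσI' : σ ∈ 𝔐.inertia (absoluteGaloisGroup (v.adicCompletion ℚ)) := by
    rw [inertia_eq_absInertia (specVal_spec v) h𝔐]; exact hσ
  have hσI : ∀ z, specVal v z ≤ 1 →
      specVal v ((absoluteGaloisGroup.toAlgEquiv (v.adicCompletion ℚ) σ) z - z) < 1 :=
    (mem_inertia_iff_spectralValuation (specVal_spec v) h𝔐).1 hσI'
  obtain ⟨Ã, hÃ, hT⟩ := exists_reducedAut_red_map_eq (w := specVal v)
    (W.baseChange (v.adicCompletion ℚ)) C hW₀ hΔ (absoluteGaloisGroup.toAlgEquiv (v.adicCompletion ℚ) σ) hσv hσI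
  -- `red(σ P') = Ã(red P')` for every `P'`
  have hT' : ∀ P' : localPoints W (v.adicCompletion ℚ), red (σ • P') =
      Affine.Point.congrEquiv hÃ (VariableChange.pointEquiv _ Ã (red P')) := by
    intro P'
    rw [hredΦ, hredΦ, hΦ₁smul]
    exact hT (Φ₁ P')
  -- the reduction `Q` of `m`: non-zero, fixed by `Ã`, of `p`-power order
  set Q := red (pointsMap W (v.adicCompletion ℚ) (m : W.geomPoints)) with hQ
  have hQ0 : Q ≠ 0 := fun h ↦ hm ((hLv m).2 h)
  have hfixQ : Affine.Point.congrEquiv hÃ (VariableChange.pointEquiv _ Ã Q) = Q := by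
    have h := (hLv _).1 hσm
    rw [AddSubgroupClass.coe_sub, primaryComponent.coe_smul, map_sub, map_sub, sub_eq_zero,
      pointsMap_absGaloisRestrict_smul, hT'] at h
    exact h
  obtain ⟨k, hk⟩ := AddCommGroup.mem_primaryComponent.mp m.2
  have hQk : p ^ k • Q = 0 := by
    rw [hQ, ← map_nsmul, ← map_nsmul, hk, map_zero, map_zero]
  have hp2 : (p ^ k).Coprime 2 :=
    Nat.Coprime.pow_left k ((Nat.coprime_primes hp.out Nat.prime_two).2 (by omega))
  have hp3 : (p ^ k).Coprime 3 :=
    Nat.Coprime.pow_left k ((Nat.coprime_primes hp.out Nat.prime_three).2 (by omega))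
  have hÃ1 : Ã = 1 :=
    VariableChange.eq_one_of_fixed_of_coprime_nsmul hÃ Q hQ0 hQk hp2 hp3 hfixQ
  rw [hT' P]
  exact congrEquiv_pointEquiv_one _ hÃ hÃ1 _

omit [W.IsElliptic] in
include hred hLv in
/-- **The dichotomy, `E[p^∞]`-form**: an inertial `σ` with `σm − m ∈ C` for ONE `m ∉ C` has
`σm' − m' ∈ C` for EVERY `m' ∈ E[p^∞]`. [cite: SerreTate1968, §2 Thm. 2 (mechanism of proof)]
[cite: SilvermanAEC2009, Prop. VII.2.1 and III.10] -/
theorem smul_sub_mem_plus_of_smul_sub_mem_plus (hp5 : 5 ≤ p)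
    {σ : absoluteGaloisGroup (v.adicCompletion ℚ)} (hσ : σ ∈ absInertia (v.adicCompletion ℚ))
    {m : W.geomPrimaryTorsion p} (hm : m ∉ Lv.plus)
    (hσm : absGaloisRestrict ℚ (v.adicCompletion ℚ) σ • m - m ∈ Lv.plus)
    (m' : W.geomPrimaryTorsion p) : absGaloisRestrict ℚ (v.adicCompletion ℚ) σ • m' - m' ∈ Lv.plus := by
  rw [hLv, AddSubgroupClass.coe_sub, primaryComponent.coe_smul, map_sub, map_sub, sub_eq_zero,
    pointsMap_absGaloisRestrict_smul]
  exact red_smul_eq_of_smul_sub_mem_plus W p hW₀ hΔ red hred Lv hLv hp5 hσ hm hσm _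

omit [W.IsElliptic] in
include hred hLv in
/-- **The dichotomy on `E[p^∞]/C`**: an element `τ ∈ D_v` lying in the inertia group that fixes ONE
non-zero vector of `Lv.Gr = E[p^∞]/C` fixes ALL of it — every inertial element acts on
`E[p^∞]/C ≅ W̃₀[p^∞]` either trivially or freely. [cite: SerreTate1968, §2 Thm. 2 (mechanism of proof)]
[cite: GreenbergLNM1716, §2 p. 73] -/
theorem smul_eq_self_of_exists (hp5 : 5 ≤ p) (τ : decomp (K := ℚ) v)
    (hτ : (τ : absoluteGaloisGroup ℚ) ∈ inertia v) (h : ∃ d : Lv.Gr, d ≠ 0 ∧ τ • d = d) :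
    ∀ d : Lv.Gr, τ • d = d := by
  obtain ⟨d₀, hd₀, hτd₀⟩ := h
  obtain ⟨σ, hσI, hστ⟩ := Subgroup.mem_map.1 hτ
  obtain ⟨m₀, rfl⟩ := Lv.grMk_surjective d₀
  have hm₀ : m₀ ∉ Lv.plus := fun h0 ↦ hd₀ (by
    rw [← AddMonoidHom.mem_ker, LocalDatum.ker_grMk]; exact h0)
  have key : ∀ m : W.geomPrimaryTorsion p, (τ • Lv.grMk m = Lv.grMk m ↔
      absGaloisRestrict ℚ (v.adicCompletion ℚ) σ • m - m ∈ Lv.plus) := fun m ↦ by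
    rw [LocalDatum.smul_grMk, ← sub_eq_zero, ← map_sub, ← AddMonoidHom.mem_ker, LocalDatum.ker_grMk,
      ← hστ]
    rfl
  intro d
  obtain ⟨m, rfl⟩ := Lv.grMk_surjective d
  exact (key m).2 (smul_sub_mem_plus_of_smul_sub_mem_plus W p hW₀ hΔ red hred Lv hLv hp5 hσI hm₀
    ((key m₀).1 hτd₀) m)

/-! ## §3 A free element of `I_v ∩ ker κ` from a prime-to-`p` normal fixing level -/

omit [W.IsElliptic] hp in
include hred hLv in
/-- An inertial `σ ∈ Γ_{ℚ_v}` whose restriction lies in a level `U` whose local elements fix `C`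
acts trivially on `E[p^∞]/C`: `σm − m ∈ C` for every `m` (K2 `smul_sub_mem_plus_of_map_eq`).
[cite: SilvermanAEC2009, Prop. VII.2.1] -/
theorem smul_sub_mem_plus_of_mem_level (U : Subgroup (absoluteGaloisGroup ℚ))
    (hUC : ∀ σ : absoluteGaloisGroup (v.adicCompletion ℚ),
      absGaloisRestrict ℚ (v.adicCompletion ℚ) σ ∈ U →
        C.map ((absoluteGaloisGroup.toAlgEquiv (v.adicCompletion ℚ) σ :
          AlgebraicClosure (v.adicCompletion ℚ) ≃ₐ[v.adicCompletion ℚ]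
            AlgebraicClosure (v.adicCompletion ℚ)) :
          AlgebraicClosure (v.adicCompletion ℚ) →+* AlgebraicClosure (v.adicCompletion ℚ)) = C)
    {σ : absoluteGaloisGroup (v.adicCompletion ℚ)} (hσI : σ ∈ absInertia (v.adicCompletion ℚ))
    (hσU : absGaloisRestrict ℚ (v.adicCompletion ℚ) σ ∈ U) (m : W.geomPrimaryTorsion p) :
    absGaloisRestrict ℚ (v.adicCompletion ℚ) σ • m - m ∈ Lv.plus := by
  refine smul_sub_mem_plus_of_map_eq W p hW₀ hΔ red hred Lv hLv hσI (hUC σ hσU)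
    (pointsMap W (v.adicCompletion ℚ) (m : W.geomPoints)) _ ?_
  rw [AddSubgroupClass.coe_sub, primaryComponent.coe_smul, map_sub, pointsMap_absGaloisRestrict_smul]

include hred hLv hord in
/-- **`E[p^∞]/C` has NO non-zero vector fixed by `I_v ∩ Gal(ℚ̄/ℚ_∞)`** (`p ≥ 5`, `E` BAD at
`v ∋ p`, `κ` the cyclotomic `ℤ_p`-extension), given an open NORMAL `U ≤ Γ_ℚ` with `p ∤ [Γ_ℚ : U]`
whose local elements fix `C` — the input `hfix` of p05 F3
`greenbergKer_eq_strictKer_of_forall_fixed_eq_zero`. An inertial `σ₀` moves `E[p^∞]/C` (F-A3,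
Néron–Ogg–Shafarevich); `σ^{[Γ:U]}` fixes `C` for every `σ` (`Subgroup.pow_index_mem`), so acts
trivially; hence the permutation of `E[p^∞]/C` induced by `σ₀` has order prime to `p`, and
`σ₀^{p^B}` still moves it; X2's `exists_layer_le_kappa_inertia` ("inertia fills every layer of
`ℚ_∞/ℚ`") supplies `w ∈ U ∩ I_v` with `κ w = κ σ₀^{p^B}`; `τ := σ₀^{p^B} w⁻¹ ∈ I_v ∩ ker κ` moves
`E[p^∞]/C`, hence acts freely by the dichotomy (§2). [cite: GreenbergLNM1716, §2 p. 73]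
[cite: Greenberg1989, §1 p. 98] [cite: SerreTate1968, §2 Thm. 2 and Cor. 2] -/
theorem forall_fixed_eq_zero_of_goodModel_of_level (hp5 : 5 ≤ p) (κ : ZpExtension ℚ p)
    (hκ : κ.IsCyclotomic) (hpv : ((p : ℕ) : 𝓞 ℚ) ∈ v.asIdeal) (hbad : ¬ W.HasGoodReductionAt v)
    (U : Subgroup (absoluteGaloisGroup ℚ)) [U.Normal] (hUo : IsOpen (U : Set (absoluteGaloisGroup ℚ)))
    (hcop : U.index.Coprime p)
    (hUC : ∀ σ : absoluteGaloisGroup (v.adicCompletion ℚ),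
      absGaloisRestrict ℚ (v.adicCompletion ℚ) σ ∈ U →
        C.map ((absoluteGaloisGroup.toAlgEquiv (v.adicCompletion ℚ) σ :
          AlgebraicClosure (v.adicCompletion ℚ) ≃ₐ[v.adicCompletion ℚ]
            AlgebraicClosure (v.adicCompletion ℚ)) :
          AlgebraicClosure (v.adicCompletion ℚ) →+* AlgebraicClosure (v.adicCompletion ℚ)) = C) :
    ∀ d : Lv.Gr, (∀ x : inertiaIn κ.kerSubgroup v, x • d = d) → d = 0 := by
  -- an inertial element moving `E[p^∞]/C`
  obtain ⟨σ₀, hσ₀I, m₀, hm₀⟩ :=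
    exists_inertia_smul_sub_not_mem_plus W p hW₀ hΔ red hred hord Lv hLv hpv hbad
  set g : decomp (K := ℚ) v := ⟨absGaloisRestrict ℚ (v.adicCompletion ℚ) σ₀, ⟨σ₀, rfl⟩⟩ with hg
  have hgI : (g : absoluteGaloisGroup ℚ) ∈ inertia v := Subgroup.mem_map.2 ⟨σ₀, hσ₀I, rfl⟩
  have hgrMk : ∀ (δ : decomp (K := ℚ) v) (m : W.geomPrimaryTorsion p),
      (δ • Lv.grMk m = Lv.grMk m ↔ (δ : absoluteGaloisGroup ℚ) • m - m ∈ Lv.plus) := fun δ m ↦ by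
    rw [LocalDatum.smul_grMk, ← sub_eq_zero, ← map_sub, ← AddMonoidHom.mem_ker, LocalDatum.ker_grMk]
  have hg_ne : g • Lv.grMk m₀ ≠ Lv.grMk m₀ := fun h ↦ hm₀ ((hgrMk g m₀).1 h)
  -- `g ^ [Γ : U]` acts trivially: the permutation `π` of `E[p^∞]/C` induced by `g` has order `∣ [Γ : U]`
  set π : Equiv.Perm Lv.Gr := MulAction.toPermHom (decomp (K := ℚ) v) Lv.Gr g with hπ
  have hπpow : ∀ (n : ℕ) (d : Lv.Gr), (π ^ n) d = (g ^ n) • d := fun n d ↦ by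
    rw [hπ, ← map_pow]; rfl
  have hπn : π ^ U.index = 1 := by
    ext d
    obtain ⟨m, rfl⟩ := Lv.grMk_surjective d
    rw [hπpow, Equiv.Perm.coe_one, id_eq]
    have hσU : absGaloisRestrict ℚ (v.adicCompletion ℚ) (σ₀ ^ U.index) ∈ U := by
      rw [map_pow]; exact U.pow_index_mem _
    refine (hgrMk _ m).2 ?_
    rw [SubgroupClass.coe_pow, hg, ← map_pow]
    exact smul_sub_mem_plus_of_mem_level W p hW₀ hΔ red hred Lv hLv U hUC
      (Subgroup.pow_mem _ hσ₀I U.index) hσU m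
  have hordπ : orderOf π ∣ U.index := orderOf_dvd_of_pow_eq_one hπn
  -- the layer bound `B` for the open normal subgroup `U ∩ D_v` of `D_v`
  set U' : Subgroup (decomp (K := ℚ) v) := U.subgroupOf (decomp v) with hU'
  haveI : U'.Normal := by rw [hU']; infer_instance
  have hU'o : IsOpen (U' : Set (decomp (K := ℚ) v)) := hUo.preimage continuous_subtype_val
  obtain ⟨B, hB⟩ := exists_layer_le_kappa_inertia κ v hκ hpv U' hU'o
  -- `u = g ^ (p ^ B)` still moves `E[p^∞]/C`
  set u : decomp (K := ℚ) v := g ^ (p ^ B) with hu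
  have hu_ne : u • Lv.grMk m₀ ≠ Lv.grMk m₀ := by
    intro h
    have hcopB : (p ^ B).Coprime (orderOf π) :=
      (Nat.Coprime.pow_left B hcop.symm).coprime_dvd_right hordπ
    obtain ⟨c, hc⟩ := exists_pow_eq_self_of_coprime hcopB
    apply hg_ne
    have h1 : (π ^ p ^ B) (Lv.grMk m₀) = Lv.grMk m₀ := by rw [hπpow]; exact h
    have h2 := Equiv.Perm.pow_apply_eq_self_of_apply_eq_self h1 c
    rw [hc] at h2
    have e := hπpow 1 (Lv.grMk m₀)
    rw [pow_one, pow_one] at e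
    rw [← e]
    exact h2
  -- `w ∈ U ∩ I_v` with `κ w = κ u`, acting trivially; `τ = u * w⁻¹ ∈ I_v ∩ ker κ`
  have hκu : (p : ℤ_[p]) ^ B ∣ (κ (u : absoluteGaloisGroup ℚ)).toAdd := by
    rw [hu, SubgroupClass.coe_pow, map_pow, toAdd_pow, nsmul_eq_mul]
    push_cast
    exact Dvd.intro _ rfl
  obtain ⟨w, hwU, hwI, hκw⟩ := hB u hκu
  have hτker : ((u * w⁻¹ : decomp (K := ℚ) v) : absoluteGaloisGroup ℚ) ∈ κ.kerSubgroup := by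
    rw [ZpExtension.mem_kerSubgroup, Subgroup.coe_mul, Subgroup.coe_inv, map_mul, map_inv, hκw,
      mul_inv_cancel]
  have hτI : ((u * w⁻¹ : decomp (K := ℚ) v) : absoluteGaloisGroup ℚ) ∈ inertia v := by
    rw [Subgroup.coe_mul, Subgroup.coe_inv]
    refine (inertia v).mul_mem ?_ ((inertia v).inv_mem hwI)
    rw [hu, SubgroupClass.coe_pow]
    exact (inertia v).pow_mem hgI _
  -- `w` acts trivially on `E[p^∞]/C`
  have hw_triv : ∀ d : Lv.Gr, w • d = d := by
    intro d
    obtain ⟨m, rfl⟩ := Lv.grMk_surjective d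
    obtain ⟨σw, hσwI, hσw⟩ := Subgroup.mem_map.1 hwI
    have hσw' : absGaloisRestrict ℚ (v.adicCompletion ℚ) σw = (w : absoluteGaloisGroup ℚ) := hσw
    have hσwU : absGaloisRestrict ℚ (v.adicCompletion ℚ) σw ∈ U := by
      rw [hσw']; exact Subgroup.mem_subgroupOf.1 hwU
    refine (hgrMk w m).2 ?_
    rw [← hσw']
    exact smul_sub_mem_plus_of_mem_level W p hW₀ hΔ red hred Lv hLv U hUC hσwI hσwU m
  have hτ_ne : (u * w⁻¹) • Lv.grMk m₀ ≠ Lv.grMk m₀ := by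
    intro h
    apply hu_ne
    have hw' : w⁻¹ • Lv.grMk m₀ = Lv.grMk m₀ := by
      rw [inv_smul_eq_iff]; exact (hw_triv _).symm
    rwa [mul_smul, hw'] at h
  -- conclusion by the dichotomy
  intro d hd
  by_contra hd0
  have hfix := hd ⟨u * w⁻¹, (mem_inertiaIn_iff κ.kerSubgroup v _).2 ⟨hτker, hτI⟩⟩
  exact hτ_ne (smul_eq_self_of_exists W p hW₀ hΔ red hred Lv hLv hp5 (u * w⁻¹) hτI ⟨d, hd0, hfix⟩ _)

end Summit.BirchSwinnertonDyer.Rank1Residual.Additive.GoodModelLine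

end
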